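import Summits.CriticalPhenomena.SAWScalingLimit.Theorems.SAWLoopFugacityFlowIsingBoundaryRatioRoughHalfAnnulusRSWMesh
import Summits.CriticalPhenomena.SAWScalingLimit.Theorems.SAWLoopFugacityFlowIsingBoundaryRatioRoughHalfAnnulusRSWPath
import Summits.CriticalPhenomena.SAWScalingLimit.Theorems.SAWLoopFugacityFlowIsingBoundaryRatioWindowRectDefs
import HarnessLib

/-!
# The rough half-annulus RSW residual in LARGE-MODULUS form (line `fk-anchor-transfer`, rev 8)
(crux `SAWLoopFugacityFlow.IsingBoundaryRatio`, stmt-CriticalPhenomena-10650)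

The large-modulus twins (`∃ M₀ > 1, ∀ M ≥ M₀` in place of `∀ M > 1`, definitions in
`…IsingBoundaryRatioWindowRectDefs.lean`) of the two landed reductions of the RSW residual:

* `roughHalfAnnulusRSWMeshLarge_of_bounds` — twin of `roughHalfAnnulusRSWMesh_of_bounds`
  (`…RoughHalfAnnulusRSWMesh.lean`): `AnnSideCrossSeparation → ChartDiscOneComponent →
  HalfAnnulusSideCrossingBound → HalfAnnulusRimCrossingBoundLarge → RoughHalfAnnulusRSWMeshLargeOf AnnPathSepG`.
  The large form of the rim bound carries the extra hypothesis that the volume contains the chart disc of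
  radius `Mρ`; it is discharged exactly as for the side bound: a radial crossing is a link
  (`annLink_of_annCross`), and a linked volume contains the chart disc (`forall_mem_of_annLink`); without a
  link the radial crossing event is empty.
* `roughHalfAnnulusRSWLargeOf_of_meshLargeOf`, `roughHalfAnnulusRSWPathLarge_of_pathMeshLarge` — twins of
  `roughHalfAnnulusRSWOf_of_meshOf` / `roughHalfAnnulusRSWPath_of_pathMesh` (`…RoughHalfAnnulusRSW.lean`,
  `…RoughHalfAnnulusRSWPath.lean`): the mesh-graph form with extremal boundary conditions implies the
  conditional-cylinder form, modulus by modulus (the landed proof is pointwise in `M`).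

Everything here is proved from the landed pieces; no definition, no named fact.
-/

noncomputable section

open scoped Classical Topology
open Filter Set Metric SimpleGraph MeasureTheory
open Literature.Probability.LatticeModels Literature.Probability.RandomPlanarGeometry
open Literature.Probability.Percolation (BondConfig)
open UpperHalfPlane (upperHalfPlaneSet)

namespace Summit.CriticalPhenomena.SAWScalingLimit.Theorems.IsingBoundaryRatio

variable {Λ : Finset (Site 2)}

/-- A radial crossing is in particular a link from the inside to the outside. [folklore] -/
theorem annLink_of_annCross {H : SimpleGraph Λ} {In Ann : Set Λ} {ω : BondConfig Λ}
    (h : AnnCross H In Ann ω) : AnnLink H In Ann := by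
  obtain ⟨a, b, p, ha, hb, -, -⟩ := h
  exact ⟨a, b, p, ha, hb⟩

/-- **The mesh-graph RSW residual in large-modulus form from its four pieces** (twin of
`roughHalfAnnulusRSWMesh_of_bounds`): the constant at modulus `M ≥ M₀` is `min (min c₂ c₃) 1` with `c₂`
from the side bound and `c₃` from the large-modulus rim bound; in both clauses the canonical-volume
hypothesis is obtained from the link through `forall_mem_of_annLink`, and without a link the guarded
separation event is sure while the radial crossing event is empty. [folklore] -/
theorem roughHalfAnnulusRSWMeshLarge_of_bounds (h1 : AnnSideCrossSeparation) (h4 : ChartDiscOneComponent)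
    (h2 : HalfAnnulusSideCrossingBound) (h3 : HalfAnnulusRimCrossingBoundLarge) :
    RoughHalfAnnulusRSWMeshLargeOf AnnPathSepG := by
  intro D φ hφ
  obtain ⟨M₀, hM₀, h3M⟩ := h3 D φ hφ
  refine ⟨M₀, hM₀, fun M hMM => ?_⟩
  have hM : 1 < M := hM₀.trans_le hMM
  have hM0 : 0 < M := one_pos.trans hM
  obtain ⟨c₂, hc₂, h2'⟩ := h2 D φ hφ M hM
  obtain ⟨c₃, hc₃, h3'⟩ := h3M M hMM
  refine ⟨min (min c₂ c₃) 1, lt_min (lt_min hc₂ hc₃) one_pos, fun ε hε => ?_⟩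
  obtain ⟨ρ₁, hρ₁, h1'⟩ := h1 D φ hφ M hM ε hε
  obtain ⟨ρ₂, hρ₂, h2''⟩ := h2' ε hε
  obtain ⟨ρ₃, hρ₃, h3''⟩ := h3' ε hε
  obtain ⟨R₀, hR₀, h4'⟩ := h4 D φ hφ ε hε
  refine ⟨min (min ρ₁ (R₀ / M)) (min ρ₂ ρ₃),
    lt_min (lt_min hρ₁ (div_pos hR₀ hM0)) (lt_min hρ₂ hρ₃), fun ρ hρ hρlt => ?_⟩
  have hρ1 : ρ < ρ₁ := hρlt.trans_le ((min_le_left _ _).trans (min_le_left _ _))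
  have hρR : M * ρ < R₀ := by
    have := hρlt.trans_le ((min_le_left _ _).trans (min_le_right _ _))
    rwa [lt_div_iff₀ hM0, mul_comm] at this
  have hρ2 : ρ < ρ₂ := hρlt.trans_le ((min_le_right _ _).trans (min_le_left _ _))
  have hρ3 : ρ < ρ₃ := hρlt.trans_le ((min_le_right _ _).trans (min_le_right _ _))
  have hρM : ρ < M * ρ := lt_mul_left hρ hM
  obtain ⟨hr1, hr12, hr2⟩ := window_bounds hM hρ
  have hp : (1 - Real.exp (-2 * criticalBetaTwo)) ∈ Set.Icc (0 : ℝ) 1 :=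
    fkIsingParam_mem_Icc criticalBetaTwo_pos.le
  filter_upwards [h1' ρ _ _ hρ hρ1 hr1 hr12 hr2, h2'' ρ hρ hρ2, h3'' ρ hρ hρ3,
    h4' (M * ρ) (mul_pos hM0 hρ) hρR] with δ hδ1 hδ2 hδ3 hδ4 Λ hLA
  intro H In Ann
  haveI : IsProbabilityMeasure (rcMeasure (fromEdgeSet (↑(annEdgeFinset H Ann) : Set (Sym2 Λ)))
      (1 - Real.exp (-2 * criticalBetaTwo)) 2 ∅) :=
    isProbabilityMeasure_rcMeasure _ hp two_pos ∅
  constructor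
  · by_cases hlink : AnnLink H In Ann
    · have hvol := forall_mem_of_annLink (φ := φ) le_rfl hρM hLA hδ4 hlink
      have key := hδ2 Λ hLA hvol
      calc min (min c₂ c₃) 1 ≤ c₂ := (min_le_left _ _).trans (min_le_left _ _)
        _ ≤ _ := key
        _ ≤ _ := measureReal_mono fun ω hω _ => hδ1 Λ ω hω
    · have huniv : {ω : BondConfig Λ | AnnPathSepG H In Ann ω} = univ :=
        eq_univ_of_forall fun ω hl => absurd hl hlink
      rw [huniv, probReal_univ]
      exact min_le_right _ _
  · by_cases hlink : AnnLink H In Ann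
    · have hvol := forall_mem_of_annLink (φ := φ) le_rfl hρM hLA hδ4 hlink
      calc _ ≤ 1 - c₃ := hδ3 Λ hLA hvol
        _ ≤ 1 - min (min c₂ c₃) 1 := by linarith [min_le_left (min c₂ c₃) 1, min_le_right c₂ c₃]
    · have hempty : {ω : BondConfig Λ | AnnCross H In Ann ω} = ∅ :=
        eq_empty_of_forall_notMem fun ω hω => hlink (annLink_of_annCross hω)
      rw [hempty, measureReal_empty]
      linarith [min_le_right (min c₂ c₃) 1]

/-- The same, in closed form (registered sub-goal of stmt-CriticalPhenomena-10650). [folklore] -/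
theorem roughHalfAnnulusRSWMeshLarge_of_bounds' : AnnSideCrossSeparation → ChartDiscOneComponent → HalfAnnulusSideCrossingBound → HalfAnnulusRimCrossingBoundLarge → RoughHalfAnnulusRSWMeshLargeOf AnnPathSepG :=
  roughHalfAnnulusRSWMeshLarge_of_bounds

/-- **The reduction to the conditional-cylinder form, large-modulus version, for any admissible separation
event** (twin of `roughHalfAnnulusRSWOf_of_meshOf`, whose proof is pointwise in the modulus).
[cite: Grimmett2006, Lemma (4.13) and Lemma (4.14)(b)] -/
theorem roughHalfAnnulusRSWLargeOf_of_meshLargeOf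
    (Sep : ∀ {Λ : Finset (Site 2)}, SimpleGraph Λ → Set Λ → Set Λ → BondConfig Λ → Prop)
    (hmono : ∀ {Λ : Finset (Site 2)} (H : SimpleGraph Λ) (In Ann : Set Λ),
      IsUpperSet {ω : BondConfig Λ | Sep H In Ann ω})
    (hloc : ∀ {Λ : Finset (Site 2)} (H : SimpleGraph Λ) (In Ann : Set Λ) (ω : BondConfig Λ),
      ω ⊆ H.edgeSet → (Sep H In Ann (ω ∩ ↑(annEdgeFinset H Ann)) ↔ Sep H In Ann ω))
    (hag : ∀ {Λ : Finset (Site 2)} {H H' : SimpleGraph Λ} {In Ann : Set Λ},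
      (∀ u ∈ In ∪ Ann, ∀ v, H.Adj u v ↔ H'.Adj u v) →
        ∀ ω : BondConfig Λ, Sep H In Ann ω ↔ Sep H' In Ann ω)
    (hmesh : RoughHalfAnnulusRSWMeshLargeOf Sep) : RoughHalfAnnulusRSWLargeOf Sep := by
  intro D φ hφ
  obtain ⟨M₀, hM₀, hM⟩ := hmesh D φ hφ
  refine ⟨M₀, hM₀, fun M hMM => ?_⟩
  have hM1 : 1 < M := hM₀.trans_le hMM
  obtain ⟨c, hc, hcε⟩ := hM M hMM
  refine ⟨c, hc, fun ε hε => ?_⟩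
  obtain ⟨ρ₀, hρ₀, hρ⟩ := hcε ε hε
  obtain ⟨ρ₁, hρ₁, hρ'⟩ := exists_forall_not_adj_of_mem_annIn hφ hM1 hε
  refine ⟨min ρ₀ ρ₁, lt_min hρ₀ hρ₁, fun ρ hρpos hρlt => ?_⟩
  filter_upwards [hρ ρ hρpos (hρlt.trans_le (min_le_left _ _)),
    hρ' ρ hρpos (hρlt.trans_le (min_le_right _ _))] with δ hδ hδ' G _ Λ hLA ξ
  intro H In Ann U P
  have hp : (1 - Real.exp (-2 * criticalBetaTwo)) ∈ Set.Icc (0 : ℝ) 1 :=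
    fkIsingParam_mem_Icc criticalBetaTwo_pos.le
  set H' : SimpleGraph Λ := (discreteDomainGraph D.carrier δ).comap Subtype.val with hH'
  have hagr : ∀ u ∈ In ∪ Ann, ∀ v : Λ, H.Adj u v ↔ H'.Adj u v :=
    adj_comap_iff_of_localAgreement (φ := φ) (M := M) (ρ := ρ) hLA
  have hagr' : ∀ u ∈ In ∪ Ann, ∀ v : Λ, H'.Adj u v ↔ H.Adj u v := fun u hu v => (hagr u hu v).symm
  have hE : annEdgeFinset H Ann = annEdgeFinset H' Ann :=
    annEdgeFinset_eq_of_agree fun u hu => hagr u (Or.inr hu)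
  have hS : {ω : BondConfig Λ | Sep H In Ann ω} = {ω | Sep H' In Ann ω} := Set.ext (hag hagr)
  have hC : {ω : BondConfig Λ | AnnCross H In Ann ω} = {ω | AnnCross H' In Ann ω} :=
    Set.ext fun ω => ⟨annCross_of_agree hagr, annCross_of_agree hagr'⟩
  obtain ⟨h1', h2'⟩ := hδ Λ (localAgreement_discreteDomainGraph hLA)
  have h1 : c ≤ (rcMeasure (fromEdgeSet (↑(annEdgeFinset H Ann) : Set (Sym2 Λ)))
      (1 - Real.exp (-2 * criticalBetaTwo)) 2 ∅).real {ω | Sep H In Ann ω} := by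
    rw [hE, hS]; exact h1'
  have h2 : (rcMeasure (fromEdgeSet (↑(annEdgeFinset H Ann) : Set (Sym2 Λ)))
      (1 - Real.exp (-2 * criticalBetaTwo)) 2 Annᶜ).real {ω | AnnCross H In Ann ω} ≤ 1 - c := by
    rw [hE, hC]; exact h2'
  have key := cylinder_bounds_of_local H In Ann (Sep H In Ann) (hmono H In Ann) (hloc H In Ann) hp
    (hδ' G Λ hLA) h1 h2 ξ
  rwa [coe_annEdgeFinset] at key

/-- **The reduction for the path form, large-modulus version** (`Sep = AnnPathSepG`; twin of
`roughHalfAnnulusRSWPath_of_pathMesh`; registered sub-goal of stmt-CriticalPhenomena-10650).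
[cite: Grimmett2006, Lemma (4.13) and Lemma (4.14)(b)] -/
theorem roughHalfAnnulusRSWPathLarge_of_pathMeshLarge : RoughHalfAnnulusRSWMeshLargeOf AnnPathSepG → RoughHalfAnnulusRSWLargeOf AnnPathSepG :=
  fun h => roughHalfAnnulusRSWLargeOf_of_meshLargeOf AnnPathSepG isUpperSet_annPathSepG
    (fun _ _ _ _ _ => annPathSepG_inter_annEdgeFinset_iff) (fun hag ω => annPathSepG_iff_of_agree hag ω) h

end Summit.CriticalPhenomena.SAWScalingLimit.Theorems.IsingBoundaryRatio

end
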